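import Mathlib.LinearAlgebra.Matrix.SesquilinearForm
import Summits.ValiantsHypothesis.ValiantsHypothesis.Theorems.SymPencilPerFourPeeledTwoPencilDesign

/-!
# Route `SymPencil` — inner rank of the `2 | 2` row split of `per_4`, PEELED case: the POINTWISE
# two-pencil reduction and its MIRROR (`--supports` stmt-ValiantsHypothesis-5674
# `SdcSuperquadratic`; (8,8) column, desk #370 (C) «π3 re-cut per family»; rung currency only)

`…TwoPencilReduction.false_of_peeled_of_frames` asked for a two-pencil frame for EVERY
`Ψ ∈ K^{4×4}`, which is false at the pure swap `Ψ = λ(E_ij + E_ji)` (crit-5 g4, desk #370 (B)).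
This file replaces the `∀Ψ`-packaging by the honest PER-FAMILY statements:

* `exists_matrix_of_rank_one` — a biadditive, bihomogeneous block `β(a,x) ∈ K·v₀` (`v₀ ≠ 0`) is
  `β(a,x) = (aᵀ Ψ x)·v₀` for a (unique, `matrix_unique_of_repr`) matrix `Ψ`;
* `false_of_peeled_of_frame_at` — a reduced peeled family on `≤ 11` squares is contradictory as
  soon as THE matrix `Ψ` of its scalar block `t(a,0)(x,0) = (aᵀΨx)·v₀` carries a two-pencil
  frame (the package of `…TwoPencilDesign.false_of_frame`, stated verbatim as in `hframes`);
* `false_of_peeled_of_frame_at_mirror` — the same with the matrix `Ψ′` of the OTHER scalar block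
  `t(0,b)(0,x) = (bᵀΨ′x)·v₀′`, via the mirrored family `t^m_r((a,b),(y,z)) = t_r((b,a),(z,y))`
  (row swaps `(01)(23)` of the permanent), which exchanges the two blocks;
* ★ `exists_frameless_pair_of_peeled` — hence a reduced peeled family on `≤ 11` squares has BOTH
  correction matrices `Ψ, Ψ′` FRAMELESS.  The remaining `(8,8,11)` question is thereby cut to:
  «frameless ⇒ pure swap» (coverage atlas, memo §9) + «both pure swaps ⇒ impossible» (p6 g16's
  corner memo).

Honest framing: no cell closes here; the window `28 ≤ sdc(per₄) ≤ 29` of record, the crux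
`SdcSuperquadratic` and `VP ≠ VNP` are untouched.  No definitions, no named facts. [folklore]
-/

noncomputable section

-- single-conjunct layout: Sub = Summit, duplicated namespace component intended
set_option linter.dupNamespace false

namespace Summit.ValiantsHypothesis.ValiantsHypothesis.Theorems.SymPencilPerFourPeeledTwoPencilFrameless

open Matrix Finset Module
open Summit.ValiantsHypothesis.ValiantsHypothesis.Theorems.SymPencilPerFourInnerRankRows
open Summit.ValiantsHypothesis.ValiantsHypothesis.Theorems.SymPencilPerFourPeeledTwoPencilDesign

universe u v

variable {K : Type u} [Field K]

/-- **A rank-one biadditive block is `(aᵀ Ψ x)·v₀`.** [folklore] -/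
theorem exists_matrix_of_rank_one {κ : Type v} (β : (Fin 4 → K) → (Fin 4 → K) → κ → K)
    (h₁ : ∀ a a' x, β (a + a') x = β a x + β a' x)
    (h₂ : ∀ (μ : K) a x, β (μ • a) x = μ • β a x)
    (h₃ : ∀ a x x', β a (x + x') = β a x + β a x')
    (h₄ : ∀ (μ : K) a x, β a (μ • x) = μ • β a x)
    (v₀ : κ → K) (hv₀ : ∀ a x, ∃ s : K, β a x = s • v₀) (hne : v₀ ≠ 0) :
    ∃ Ψ : Matrix (Fin 4) (Fin 4) K, ∀ a x r, β a x r = (a ⬝ᵥ Ψ *ᵥ x) * v₀ r := by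
  classical
  obtain ⟨r₀, hr₀⟩ : ∃ r, v₀ r ≠ 0 := by
    by_contra h
    push Not at h
    exact hne (funext h)
  let ψ : (Fin 4 → K) → (Fin 4 → K) → K := fun a x => β a x r₀ / v₀ r₀
  have hψ : ∀ a x r, β a x r = ψ a x * v₀ r := by
    intro a x r
    obtain ⟨s, hs⟩ := hv₀ a x
    have e : ∀ r', β a x r' = s * v₀ r' := fun r' => by rw [hs]; rfl
    have : ψ a x = s := by
      show β a x r₀ / v₀ r₀ = s
      rw [e r₀, mul_div_assoc, div_self hr₀, mul_one]
    rw [this, e r]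
  let B : (Fin 4 → K) →ₗ[K] (Fin 4 → K) →ₗ[K] K := LinearMap.mk₂ K ψ
    (fun a a' x => by
      show β (a + a') x r₀ / v₀ r₀ = β a x r₀ / v₀ r₀ + β a' x r₀ / v₀ r₀
      rw [h₁, Pi.add_apply, add_div])
    (fun μ a x => by
      show β (μ • a) x r₀ / v₀ r₀ = μ • (β a x r₀ / v₀ r₀)
      rw [h₂, Pi.smul_apply, smul_eq_mul, smul_eq_mul, mul_div_assoc])
    (fun a x x' => by
      show β a (x + x') r₀ / v₀ r₀ = β a x r₀ / v₀ r₀ + β a x' r₀ / v₀ r₀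
      rw [h₃, Pi.add_apply, add_div])
    (fun μ a x => by
      show β a (μ • x) r₀ / v₀ r₀ = μ • (β a x r₀ / v₀ r₀)
      rw [h₄, Pi.smul_apply, smul_eq_mul, smul_eq_mul, mul_div_assoc])
  refine ⟨LinearMap.toMatrix₂' K B, fun a x r => ?_⟩
  rw [hψ, ← Matrix.toLinearMap₂'_apply' (T := K), Matrix.toLinearMap₂'_toMatrix',
    LinearMap.mk₂_apply]

/-- The representing matrix of a block is unique when `v₀ ≠ 0`. [folklore] -/
theorem matrix_unique_of_repr {κ : Type v} (β : (Fin 4 → K) → (Fin 4 → K) → κ → K)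
    (v₀ : κ → K) (hne : v₀ ≠ 0) (Ψ₁ Ψ₂ : Matrix (Fin 4) (Fin 4) K)
    (h1 : ∀ a x r, β a x r = (a ⬝ᵥ Ψ₁ *ᵥ x) * v₀ r)
    (h2 : ∀ a x r, β a x r = (a ⬝ᵥ Ψ₂ *ᵥ x) * v₀ r) : Ψ₁ = Ψ₂ := by
  classical
  obtain ⟨r₀, hr₀⟩ : ∃ r, v₀ r ≠ 0 := by
    by_contra h
    push Not at h
    exact hne (funext h)
  ext i k
  have := h1 (Pi.single i 1) (Pi.single k 1) r₀
  rw [h2] at this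
  have e := mul_right_cancel₀ hr₀ this
  simpa [Matrix.mulVec_single, dotProduct_single, Matrix.mulVec, dotProduct,
    Pi.single_apply] using e.symm

/-- **Pointwise two-pencil reduction.**  A reduced peeled family on `≤ 11` squares is
contradictory once the matrix `Ψ` of its scalar block `t(a,0)(x,0) = (aᵀΨx)·v₀` carries a
two-pencil frame. [folklore] -/
theorem false_of_peeled_of_frame_at [CharZero K] {κ : Type v} [Fintype κ] [DecidableEq κ]
    (hκ : Fintype.card κ ≤ 11) (c : κ → K)
    (t : κ → (((Fin 4 → K) × (Fin 4 → K)) →ₗ[K] ((Fin 4 → K) × (Fin 4 → K)) →ₗ[K] K))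
    (hJ : ∀ a b y₂ y₃ : Fin 4 → K,
      ∑ r, c r * (t r (a, b) (y₂, y₃)) ^ 2 = (Matrix.of ![a, b, y₂, y₃]).permanent)
    (v₀ v₀' : κ → K) (hv₀ : ∀ (a x : Fin 4 → K), ∃ s : K, (fun r => t r (a, 0) (x, 0)) = s • v₀)
    (hv₀' : ∀ (b x : Fin 4 → K), ∃ s : K, (fun r => t r (0, b) (0, x)) = s • v₀')
    (hpeel : ∃ a b y z : Fin 4 → K, ∑ r, c r * t r (a, 0) (y, 0) * t r (0, b) (0, z) ≠ 0)
    (hframe : ∀ Ψ : Matrix (Fin 4) (Fin 4) K,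
      (∀ (a x : Fin 4 → K) (r : κ), t r (a, 0) (x, 0) = (a ⬝ᵥ Ψ *ᵥ x) * v₀ r) →
      ∃ (a₀ a₁ y₀ y₁ : Fin 4 → K) (P₀₀ P₁₀ P₀₁ P₁₁ W₀ : Matrix (Fin 4) (Fin 4) K)
        (v : Fin 4 → Fin 4 → K) (s : Fin 4 → K) (W : Matrix (Fin 4) (Fin 4) K),
        a₀ ⬝ᵥ Ψ *ᵥ y₀ = 0 ∧ a₀ ⬝ᵥ Ψ *ᵥ y₁ = 0 ∧ a₁ ⬝ᵥ Ψ *ᵥ y₀ = 0 ∧ a₁ ⬝ᵥ Ψ *ᵥ y₁ = 0 ∧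
        (∀ b l, P₀₀ b l = (Matrix.of ![a₀, Pi.single b 1, y₀, Pi.single l 1]).permanent) ∧
        (∀ b l, P₁₀ b l = (Matrix.of ![a₀, Pi.single b 1, y₁, Pi.single l 1]).permanent) ∧
        (∀ b l, P₀₁ b l = (Matrix.of ![a₁, Pi.single b 1, y₀, Pi.single l 1]).permanent) ∧
        (∀ b l, P₁₁ b l = (Matrix.of ![a₁, Pi.single b 1, y₁, Pi.single l 1]).permanent) ∧
        W₀ * P₀₀ = 1 ∧ (∀ j, P₁₀ *ᵥ v j = s j • P₀₀ *ᵥ v j) ∧ (∀ i j, i ≠ j → s i ≠ s j) ∧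
        W * Matrix.of v = 1 ∧ P₁₁ - P₁₀ * W₀ * P₀₁ ≠ 0) :
    False := by
  classical
  obtain ⟨a', b', yy, zz, hne⟩ := hpeel
  have hv₀ne : v₀ ≠ 0 := by
    intro h0
    apply hne
    obtain ⟨s, hs⟩ := hv₀ a' yy
    refine Finset.sum_eq_zero fun r _ => ?_
    have e : t r (a', 0) (yy, 0) = s * v₀ r := by have := congr_fun hs r; simpa using this
    rw [e, h0, Pi.zero_apply, mul_zero, mul_zero, zero_mul]
  -- the block is biadditive and bihomogeneous
  obtain ⟨Ψ, hΨ⟩ := exists_matrix_of_rank_one (fun a x r => t r (a, 0) (x, 0))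
    (fun a a₂ x => by
      funext r
      have : ((a + a₂, (0 : Fin 4 → K)) : (Fin 4 → K) × (Fin 4 → K)) = (a, 0) + (a₂, 0) := by simp
      simp only [Pi.add_apply]
      rw [this, map_add, LinearMap.add_apply])
    (fun μ a x => by
      funext r
      have : ((μ • a, (0 : Fin 4 → K)) : (Fin 4 → K) × (Fin 4 → K)) = μ • (a, 0) := by simp
      simp only [Pi.smul_apply, smul_eq_mul]
      rw [this, map_smul, LinearMap.smul_apply, smul_eq_mul])
    (fun a x x₂ => by
      funext r
      have : ((x + x₂, (0 : Fin 4 → K)) : (Fin 4 → K) × (Fin 4 → K)) = (x, 0) + (x₂, 0) := by simp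
      simp only [Pi.add_apply]
      rw [this, map_add])
    (fun μ a x => by
      funext r
      have : ((μ • x, (0 : Fin 4 → K)) : (Fin 4 → K) × (Fin 4 → K)) = μ • (x, 0) := by simp
      simp only [Pi.smul_apply, smul_eq_mul]
      rw [this, map_smul, smul_eq_mul])
    v₀ hv₀ hv₀ne
  obtain ⟨a₀, a₁, y₀, y₁, P₀₀, P₁₀, P₀₁, P₁₁, W₀, v, s, W, h00, h01, h10, h11, hP₀₀, hP₁₀, hP₀₁, hP₁₁,
    hW₀, hv, hs, hW, hQ⟩ := hframe Ψ hΨ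
  have hzero : ∀ (a y : Fin 4 → K), a ⬝ᵥ Ψ *ᵥ y = 0 → ∀ r, t r (a, 0) (y, 0) = 0 := by
    intro a y h r
    rw [hΨ, h, zero_mul]
  exact false_of_frame hκ c t hJ v₀ v₀' hv₀ hv₀' ⟨a', b', yy, zz, hne⟩ a₀ a₁ y₀ y₁
    (hzero a₀ y₀ h00) (hzero a₀ y₁ h01) (hzero a₁ y₀ h10) (hzero a₁ y₁ h11)
    P₀₀ P₁₀ P₀₁ P₁₁ hP₀₀ hP₁₀ hP₀₁ hP₁₁ W₀ hW₀ v s hv hs W hW hQ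

/-- **Mirror.**  The same with the matrix `Ψ′` of the other scalar block
`t(0,b)(0,x) = (bᵀΨ′x)·v₀′`: the mirrored family `t^m_r((a,b),(y,z)) = t_r((b,a),(z,y))` is again
a reduced peeled family, with the two blocks exchanged. [folklore] -/
theorem false_of_peeled_of_frame_at_mirror [CharZero K] {κ : Type v} [Fintype κ]
    [DecidableEq κ]
    (hκ : Fintype.card κ ≤ 11) (c : κ → K)
    (t : κ → (((Fin 4 → K) × (Fin 4 → K)) →ₗ[K] ((Fin 4 → K) × (Fin 4 → K)) →ₗ[K] K))
    (hJ : ∀ a b y₂ y₃ : Fin 4 → K,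
      ∑ r, c r * (t r (a, b) (y₂, y₃)) ^ 2 = (Matrix.of ![a, b, y₂, y₃]).permanent)
    (v₀ v₀' : κ → K) (hv₀ : ∀ (a x : Fin 4 → K), ∃ s : K, (fun r => t r (a, 0) (x, 0)) = s • v₀)
    (hv₀' : ∀ (b x : Fin 4 → K), ∃ s : K, (fun r => t r (0, b) (0, x)) = s • v₀')
    (hpeel : ∃ a b y z : Fin 4 → K, ∑ r, c r * t r (a, 0) (y, 0) * t r (0, b) (0, z) ≠ 0)
    (hframe' : ∀ Ψ' : Matrix (Fin 4) (Fin 4) K,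
      (∀ (b x : Fin 4 → K) (r : κ), t r (0, b) (0, x) = (b ⬝ᵥ Ψ' *ᵥ x) * v₀' r) →
      ∃ (a₀ a₁ y₀ y₁ : Fin 4 → K) (P₀₀ P₁₀ P₀₁ P₁₁ W₀ : Matrix (Fin 4) (Fin 4) K)
        (v : Fin 4 → Fin 4 → K) (s : Fin 4 → K) (W : Matrix (Fin 4) (Fin 4) K),
        a₀ ⬝ᵥ Ψ' *ᵥ y₀ = 0 ∧ a₀ ⬝ᵥ Ψ' *ᵥ y₁ = 0 ∧ a₁ ⬝ᵥ Ψ' *ᵥ y₀ = 0 ∧ a₁ ⬝ᵥ Ψ' *ᵥ y₁ = 0 ∧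
        (∀ b l, P₀₀ b l = (Matrix.of ![a₀, Pi.single b 1, y₀, Pi.single l 1]).permanent) ∧
        (∀ b l, P₁₀ b l = (Matrix.of ![a₀, Pi.single b 1, y₁, Pi.single l 1]).permanent) ∧
        (∀ b l, P₀₁ b l = (Matrix.of ![a₁, Pi.single b 1, y₀, Pi.single l 1]).permanent) ∧
        (∀ b l, P₁₁ b l = (Matrix.of ![a₁, Pi.single b 1, y₁, Pi.single l 1]).permanent) ∧
        W₀ * P₀₀ = 1 ∧ (∀ j, P₁₀ *ᵥ v j = s j • P₀₀ *ᵥ v j) ∧ (∀ i j, i ≠ j → s i ≠ s j) ∧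
        W * Matrix.of v = 1 ∧ P₁₁ - P₁₀ * W₀ * P₀₁ ≠ 0) :
    False := by
  classical
  -- the mirrored family
  let sw : ((Fin 4 → K) × (Fin 4 → K)) →ₗ[K] ((Fin 4 → K) × (Fin 4 → K)) :=
    (LinearEquiv.prodComm K (Fin 4 → K) (Fin 4 → K)).toLinearMap
  let tm : κ → (((Fin 4 → K) × (Fin 4 → K)) →ₗ[K] ((Fin 4 → K) × (Fin 4 → K)) →ₗ[K] K) :=
    fun r => ((t r).comp sw).compl₂ sw
  have htm : ∀ r (a b y z : Fin 4 → K), tm r (a, b) (y, z) = t r (b, a) (z, y) := by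
    intro r a b y z; rfl
  refine false_of_peeled_of_frame_at hκ c tm ?_ v₀' v₀ ?_ ?_ ?_ ?_
  · intro a b y₂ y₃
    simp only [htm]
    rw [hJ b a y₃ y₂, per_swap_row₀₁, per_swap_row₂₃]
  · intro a x
    obtain ⟨s, hs⟩ := hv₀' a x
    exact ⟨s, by simpa only [htm] using hs⟩
  · intro b x
    obtain ⟨s, hs⟩ := hv₀ b x
    exact ⟨s, by simpa only [htm] using hs⟩
  · obtain ⟨a, b, y, z, hne⟩ := hpeel
    refine ⟨b, a, z, y, ?_⟩
    simp only [htm]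
    convert hne using 2 with r
    ring
  · intro Ψ' hΨ'
    exact hframe' Ψ' (fun b x r => by rw [← htm]; exact hΨ' b x r)

/-- ★ **A reduced peeled family on `≤ 11` squares has BOTH correction matrices frameless.**
[folklore] -/
theorem exists_frameless_pair_of_peeled [CharZero K] {κ : Type v} [Fintype κ] [DecidableEq κ]
    (hκ : Fintype.card κ ≤ 11) (c : κ → K)
    (t : κ → (((Fin 4 → K) × (Fin 4 → K)) →ₗ[K] ((Fin 4 → K) × (Fin 4 → K)) →ₗ[K] K))
    (hJ : ∀ a b y₂ y₃ : Fin 4 → K,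
      ∑ r, c r * (t r (a, b) (y₂, y₃)) ^ 2 = (Matrix.of ![a, b, y₂, y₃]).permanent)
    (v₀ v₀' : κ → K) (hv₀ : ∀ (a x : Fin 4 → K), ∃ s : K, (fun r => t r (a, 0) (x, 0)) = s • v₀)
    (hv₀' : ∀ (b x : Fin 4 → K), ∃ s : K, (fun r => t r (0, b) (0, x)) = s • v₀')
    (hpeel : ∃ a b y z : Fin 4 → K, ∑ r, c r * t r (a, 0) (y, 0) * t r (0, b) (0, z) ≠ 0) :
    ∃ Ψ Ψ' : Matrix (Fin 4) (Fin 4) K,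
      (∀ (a x : Fin 4 → K) (r : κ), t r (a, 0) (x, 0) = (a ⬝ᵥ Ψ *ᵥ x) * v₀ r) ∧
      (∀ (b x : Fin 4 → K) (r : κ), t r (0, b) (0, x) = (b ⬝ᵥ Ψ' *ᵥ x) * v₀' r) ∧
      (¬ ∃ (a₀ a₁ y₀ y₁ : Fin 4 → K) (P₀₀ P₁₀ P₀₁ P₁₁ W₀ : Matrix (Fin 4) (Fin 4) K)
        (v : Fin 4 → Fin 4 → K) (s : Fin 4 → K) (W : Matrix (Fin 4) (Fin 4) K),
        a₀ ⬝ᵥ Ψ *ᵥ y₀ = 0 ∧ a₀ ⬝ᵥ Ψ *ᵥ y₁ = 0 ∧ a₁ ⬝ᵥ Ψ *ᵥ y₀ = 0 ∧ a₁ ⬝ᵥ Ψ *ᵥ y₁ = 0 ∧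
        (∀ b l, P₀₀ b l = (Matrix.of ![a₀, Pi.single b 1, y₀, Pi.single l 1]).permanent) ∧
        (∀ b l, P₁₀ b l = (Matrix.of ![a₀, Pi.single b 1, y₁, Pi.single l 1]).permanent) ∧
        (∀ b l, P₀₁ b l = (Matrix.of ![a₁, Pi.single b 1, y₀, Pi.single l 1]).permanent) ∧
        (∀ b l, P₁₁ b l = (Matrix.of ![a₁, Pi.single b 1, y₁, Pi.single l 1]).permanent) ∧
        W₀ * P₀₀ = 1 ∧ (∀ j, P₁₀ *ᵥ v j = s j • P₀₀ *ᵥ v j) ∧ (∀ i j, i ≠ j → s i ≠ s j) ∧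
        W * Matrix.of v = 1 ∧ P₁₁ - P₁₀ * W₀ * P₀₁ ≠ 0) ∧
      (¬ ∃ (a₀ a₁ y₀ y₁ : Fin 4 → K) (P₀₀ P₁₀ P₀₁ P₁₁ W₀ : Matrix (Fin 4) (Fin 4) K)
        (v : Fin 4 → Fin 4 → K) (s : Fin 4 → K) (W : Matrix (Fin 4) (Fin 4) K),
        a₀ ⬝ᵥ Ψ' *ᵥ y₀ = 0 ∧ a₀ ⬝ᵥ Ψ' *ᵥ y₁ = 0 ∧ a₁ ⬝ᵥ Ψ' *ᵥ y₀ = 0 ∧ a₁ ⬝ᵥ Ψ' *ᵥ y₁ = 0 ∧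
        (∀ b l, P₀₀ b l = (Matrix.of ![a₀, Pi.single b 1, y₀, Pi.single l 1]).permanent) ∧
        (∀ b l, P₁₀ b l = (Matrix.of ![a₀, Pi.single b 1, y₁, Pi.single l 1]).permanent) ∧
        (∀ b l, P₀₁ b l = (Matrix.of ![a₁, Pi.single b 1, y₀, Pi.single l 1]).permanent) ∧
        (∀ b l, P₁₁ b l = (Matrix.of ![a₁, Pi.single b 1, y₁, Pi.single l 1]).permanent) ∧
        W₀ * P₀₀ = 1 ∧ (∀ j, P₁₀ *ᵥ v j = s j • P₀₀ *ᵥ v j) ∧ (∀ i j, i ≠ j → s i ≠ s j) ∧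
        W * Matrix.of v = 1 ∧ P₁₁ - P₁₀ * W₀ * P₀₁ ≠ 0) := by
  classical
  obtain ⟨a', b', yy, zz, hne⟩ := hpeel
  have hv₀ne : v₀ ≠ 0 := by
    intro h0
    apply hne
    obtain ⟨s, hs⟩ := hv₀ a' yy
    refine Finset.sum_eq_zero fun r _ => ?_
    have e : t r (a', 0) (yy, 0) = s * v₀ r := by have := congr_fun hs r; simpa using this
    rw [e, h0, Pi.zero_apply, mul_zero, mul_zero, zero_mul]
  have hv₀'ne : v₀' ≠ 0 := by
    intro h0
    apply hne
    obtain ⟨s, hs⟩ := hv₀' b' zz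
    refine Finset.sum_eq_zero fun r _ => ?_
    have e : t r (0, b') (0, zz) = s * v₀' r := by have := congr_fun hs r; simpa using this
    rw [e, h0, Pi.zero_apply, mul_zero, mul_zero]
  -- the two representing matrices
  obtain ⟨Ψ, hΨ⟩ := exists_matrix_of_rank_one (fun a x r => t r (a, 0) (x, 0))
    (fun a a₂ x => by
      funext r
      have : ((a + a₂, (0 : Fin 4 → K)) : (Fin 4 → K) × (Fin 4 → K)) = (a, 0) + (a₂, 0) := by simp
      simp only [Pi.add_apply]
      rw [this, map_add, LinearMap.add_apply])
    (fun μ a x => by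
      funext r
      have : ((μ • a, (0 : Fin 4 → K)) : (Fin 4 → K) × (Fin 4 → K)) = μ • (a, 0) := by simp
      simp only [Pi.smul_apply, smul_eq_mul]
      rw [this, map_smul, LinearMap.smul_apply, smul_eq_mul])
    (fun a x x₂ => by
      funext r
      have : ((x + x₂, (0 : Fin 4 → K)) : (Fin 4 → K) × (Fin 4 → K)) = (x, 0) + (x₂, 0) := by simp
      simp only [Pi.add_apply]
      rw [this, map_add])
    (fun μ a x => by
      funext r
      have : ((μ • x, (0 : Fin 4 → K)) : (Fin 4 → K) × (Fin 4 → K)) = μ • (x, 0) := by simp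
      simp only [Pi.smul_apply, smul_eq_mul]
      rw [this, map_smul, smul_eq_mul])
    v₀ hv₀ hv₀ne
  obtain ⟨Ψ', hΨ'⟩ := exists_matrix_of_rank_one (fun b x r => t r (0, b) (0, x))
    (fun b b₂ x => by
      funext r
      have : (((0 : Fin 4 → K), b + b₂) : (Fin 4 → K) × (Fin 4 → K)) = (0, b) + (0, b₂) := by simp
      simp only [Pi.add_apply]
      rw [this, map_add, LinearMap.add_apply])
    (fun μ b x => by
      funext r
      have : (((0 : Fin 4 → K), μ • b) : (Fin 4 → K) × (Fin 4 → K)) = μ • (0, b) := by simp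
      simp only [Pi.smul_apply, smul_eq_mul]
      rw [this, map_smul, LinearMap.smul_apply, smul_eq_mul])
    (fun b x x₂ => by
      funext r
      have : (((0 : Fin 4 → K), x + x₂) : (Fin 4 → K) × (Fin 4 → K)) = (0, x) + (0, x₂) := by simp
      simp only [Pi.add_apply]
      rw [this, map_add])
    (fun μ b x => by
      funext r
      have : (((0 : Fin 4 → K), μ • x) : (Fin 4 → K) × (Fin 4 → K)) = μ • (0, x) := by simp
      simp only [Pi.smul_apply, smul_eq_mul]
      rw [this, map_smul, smul_eq_mul])
    v₀' hv₀' hv₀'ne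
  refine ⟨Ψ, Ψ', hΨ, hΨ', fun hb => ?_, fun hb' => ?_⟩
  · refine false_of_peeled_of_frame_at hκ c t hJ v₀ v₀' hv₀ hv₀' ⟨a', b', yy, zz, hne⟩ ?_
    intro Ψ₁ hΨ₁
    rw [matrix_unique_of_repr (fun a x r => t r (a, 0) (x, 0)) v₀ hv₀ne Ψ₁ Ψ hΨ₁ hΨ]
    exact hb
  · refine false_of_peeled_of_frame_at_mirror hκ c t hJ v₀ v₀' hv₀ hv₀' ⟨a', b', yy, zz, hne⟩ ?_
    intro Ψ₁ hΨ₁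
    rw [matrix_unique_of_repr (fun b x r => t r (0, b) (0, x)) v₀' hv₀'ne Ψ₁ Ψ' hΨ₁ hΨ']
    exact hb'

end Summit.ValiantsHypothesis.ValiantsHypothesis.Theorems.SymPencilPerFourPeeledTwoPencilFrameless

end
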